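import Literature.Computability.Complexity.SharpSATNormalForm
import HarnessLib

/-!
# Lemma 3 of Liśkiewicz–Ogihara–Toda 2003: the map `φ ↦ ψ` into not-all-equal normal form,
# with properties (1), (2) and the equality of the numbers of satisfying assignments PROVED

Counting complexity, companion of `SharpSATNormalForm.lean` (the normal form
`CNF.IsLOTNormalForm`, property (2) for it, `SHARP3SATNF`, the named facts
`LOT2003_prop2_sharp3SAT`, `LOT2003_lemma3`). Source: LOT2003, §2.3, proof of Lemma 3 (held:
`paper:doi-10-1016-s0304-3975-03-00080-x`, p. 8): "First, we introduce one new variable `w` and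
a single-literal clause `(¬w)`. … for each `i`, `1 ≤ i ≤ m`, we construct from `Cᵢ` an
eight-clause formula `C̃ᵢ` as follows: Let `x`, `y`, and `z` be the three literals of `Cᵢ`. We
introduce a new variable `uᵢ` and some clauses so that every satisfying assignment of `ψ` sets
the value of `uᵢ` to the value of `x ∨ y`. This requirement can be fulfilled by introducing three
clauses … We insert the literal `w` to each of the last three clauses to make them three-literal
clauses. … we add the literal-wise complement of each of the four clauses … Then `ψ` has
`n + m + 1` variables, consists of `8m` three-literal clauses and one single-literal clause, and
has as many satisfying assignments as `φ`."

## What is here (all proved)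

* `CNF.lemma3Block m i C` — the eight clauses `C̃ᵢ` built from the `i`-th clause `C = (x ∨ y ∨ z)`
  of a formula with `m` clauses: with `w := x₀`, `uᵢ := x_{i+1}` and the variables of `φ` shifted
  by `m + 1`, the clauses `D₁ = (x ∨ y ∨ ¬uᵢ)`, `D₂ = (¬x ∨ uᵢ ∨ w)`, `D₃ = (¬y ∨ uᵢ ∨ w)`,
  `D₄ = (uᵢ ∨ z ∨ w)` (the standard clauses for `uᵢ ↔ x ∨ y` and the clause `Cᵢ` rewritten as
  `uᵢ ∨ z`, padded with `w`), each followed by its literal-wise complement;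
  `CNF.lemma3Map φ = (¬w) ∧ ⋀ᵢ C̃ᵢ` — the map `f` of Lemma 3;
* `CNF.isLOTNormalForm_lemma3Map` — `f(φ)` is in normal form (hence property (2),
  `SharpSATNormalForm.lean`);
* property (1): `CNF.length_lemma3Map` (`8m + 1` clauses), `CNF.card_vars_lemma3Map`
  (`n + m + 1` variables), for 3CNF `φ` (`CNF.IsWidthEq 3`);
* `CNF.numSat_lemma3Map` — **`#SAT(f(φ)) = #SAT(φ)`**: the satisfying assignments of `ψ` are
  exactly `w ↦ false`, `uᵢ ↦ (x ∨ y)(σ)`, shifted `σ`, for `σ` a satisfying assignment of `φ`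
  (`CNF.eval_lemma3Map_iff'`), a bijection (`Set.ncard_congr` on the description
  `CNF.numSat_eq_ncard` of `numSat` by total assignments vanishing off the occurring variables);
* `CNF.LOT2003_lemma3_formulas` — the conjunction, Lemma 3 at the level of formulas. The
  string-level reduction `LOT2003_lemma3` additionally needs the polynomial-time machine for
  `encodingCNF.encode φ ↦ encodingCNF.encode (lemma3Map φ)` (not here).

The printed displays of the clauses are lost in the held text layer; the four clauses above are
the standard ones matching the prose ("sets the value of `uᵢ` to the value of `x ∨ y`", "insert
the literal `w` to each of the last three clauses"), and the proofs below verify everything that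
is claimed about them.

## References

* M. Liśkiewicz, M. Ogihara, S. Toda, TCS 304 (2003) 129–156, §2.3, Lemma 3 and its proof.
-/

namespace Literature.Computability.Complexity

open _root_.Computability

namespace Literal

/-- Shift the variable of a literal over `ℕ` by `k` (renaming `x_v ↦ x_{v+k}`). [folklore] -/
def shift (k : ℕ) (l : Literal ℕ) : Literal ℕ :=
  (l.1 + k, l.2)

/-- The variable of a shifted literal. [folklore] -/
@[simp] theorem shift_fst (k : ℕ) (l : Literal ℕ) : (l.shift k).1 = l.1 + k := rfl

/-- A shifted literal reads the shifted assignment. [folklore] -/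
@[simp] theorem eval_shift (τ : ℕ → Bool) (k : ℕ) (l : Literal ℕ) :
    (l.shift k).eval τ = l.eval (fun v => τ (v + k)) := rfl

/-- Negation keeps the variable. [folklore] -/
@[simp] theorem negate_fst {ν : Type*} (l : Literal ν) : l.negate.1 = l.1 := rfl

end Literal

namespace CNF

/-! ### Generalities on occurring variables and `numSat` -/

/-- A variable occurs in `φ` iff it is the variable of a literal of a clause of `φ`. Private copy
of `CNF.mem_vars_iff` of `Literature/Computability/FineGrained/CliqueETH.lean` (same statement),
whose import closure (the SETH development) is not wanted here. [folklore] -/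
private theorem mem_vars_iff' {ν : Type*} [DecidableEq ν] {φ : CNF ν} {v : ν} :
    v ∈ φ.vars ↔ ∃ c ∈ φ, ∃ l ∈ c, l.1 = v := by
  unfold vars
  simp only [List.mem_toFinset, List.mem_map, List.mem_flatten]
  constructor
  · rintro ⟨l, ⟨c, hc, hl⟩, rfl⟩
    exact ⟨c, hc, l, hl, rfl⟩
  · rintro ⟨c, hc, l, hl, rfl⟩
    exact ⟨l, ⟨c, hc, hl⟩, rfl⟩

/-- **`#SAT(φ)` by total assignments**: `numSat φ` is the number of assignments `σ : ℕ → Bool`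
vanishing off the occurring variables and satisfying `φ` (the extension `extendAssignment` is a
bijection onto these). [cite: LiskiewiczOgiharaToda2003, §2.3 (#SAT)] -/
theorem numSat_eq_ncard (φ : CNF ℕ) :
    φ.numSat = {σ : ℕ → Bool | (∀ v, v ∉ φ.vars → σ v = false) ∧ φ.eval σ = true}.ncard := by
  classical
  have hinj : Function.Injective φ.extendAssignment := by
    intro σ₁ σ₂ h
    funext ⟨v, hv⟩
    have := congrFun h v
    simpa [extendAssignment, hv] using this
  rw [numSat, ← Set.ncard_coe_finset, Finset.coe_filter, ← Set.ncard_image_of_injective _ hinj]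
  congr 1
  ext τ
  simp only [Set.mem_image, Set.mem_setOf_eq, Finset.mem_univ, true_and]
  constructor
  · rintro ⟨σ, hσ, rfl⟩
    exact ⟨fun v hv => by simp [extendAssignment, hv], hσ⟩
  · rintro ⟨hoff, hτ⟩
    have hext : φ.extendAssignment (fun x : φ.vars => τ x) = τ := by
      funext v
      by_cases hv : v ∈ φ.vars
      · simp [extendAssignment, hv]
      · simp [extendAssignment, hv, hoff v hv]
    exact ⟨fun x => τ x, by rw [hext]; exact hτ, hext⟩

/-! ### The map of Lemma 3 -/

/-- **The eight clauses `C̃ᵢ`** built from the `i`-th clause `(x ∨ y ∨ z)` of a formula with `m`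
clauses (variables of `φ` shifted by `m + 1`, `w = x₀`, `uᵢ = x_{i+1}`): `D₁ = (x ∨ y ∨ ¬uᵢ)`,
`D₂ = (¬x ∨ uᵢ ∨ w)`, `D₃ = (¬y ∨ uᵢ ∨ w)`, `D₄ = (uᵢ ∨ z ∨ w)`, each followed by its literal-wise
complement. A clause that does not have exactly three literals is sent to the contradictory pair
`(w ∨ w ∨ w), (¬w ∨ ¬w ∨ ¬w)` (design choice beyond the source, whose map is defined on 3CNF
formulas only: it keeps the normal form and makes `f(φ)` unsatisfiable, so that on codes the
reduction needs no separate width test, `numSat_lemma3Map_of_not_isWidthEq`).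
[cite: LiskiewiczOgiharaToda2003, §2.3 (proof of Lemma 3, the formula C̃ᵢ)] -/
def lemma3Block (m i : ℕ) : Clause ℕ → CNF ℕ
  | [x, y, z] =>
    [[x.shift (m + 1), y.shift (m + 1), (i + 1, false)],
      Clause.complement [x.shift (m + 1), y.shift (m + 1), (i + 1, false)],
      [(x.shift (m + 1)).negate, (i + 1, true), (0, true)],
      Clause.complement [(x.shift (m + 1)).negate, (i + 1, true), (0, true)],
      [(y.shift (m + 1)).negate, (i + 1, true), (0, true)],
      Clause.complement [(y.shift (m + 1)).negate, (i + 1, true), (0, true)],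
      [(i + 1, true), z.shift (m + 1), (0, true)],
      Clause.complement [(i + 1, true), z.shift (m + 1), (0, true)]]
  | _ => [[(0, true), (0, true), (0, true)], Clause.complement [(0, true), (0, true), (0, true)]]

/-- **The map `f` of Lemma 3**: `φ ↦ ψ = (¬w) ∧ C̃₁ ∧ ⋯ ∧ C̃ₘ` (single-literal clause first).
[cite: LiskiewiczOgiharaToda2003, Lemma 3 (the function f)] -/
def lemma3Map (φ : CNF ℕ) : CNF ℕ :=
  [(0, false)] :: (φ.mapIdx fun i C => lemma3Block φ.length i C).flatten

/-- The value forced on `uᵢ`: `(x ∨ y)(σ)` for the clause `(x ∨ y ∨ z)`.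
[cite: LiskiewiczOgiharaToda2003, §2.3 (proof of Lemma 3: "sets the value of uᵢ to the value of x ∨ y")] -/
def uval (σ : ℕ → Bool) : Clause ℕ → Bool
  | x :: y :: _ => x.eval σ || y.eval σ
  | _ => false

/-- Reading an assignment of `ψ` back on the variables of `φ` (undo the shift by `m + 1`).
[cite: LiskiewiczOgiharaToda2003, §2.3 (proof of Lemma 3)] -/
def backShift (m : ℕ) (τ : ℕ → Bool) : ℕ → Bool :=
  fun v => τ (v + (m + 1))

/-- The assignment of `ψ = f(φ)` determined by an assignment `σ` of `φ`: `w ↦ false`,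
`uᵢ ↦ (x ∨ y)(σ)`, `x_{v+m+1} ↦ σ(x_v)`. [cite: LiskiewiczOgiharaToda2003, §2.3 (proof of Lemma 3)] -/
def backMap (φ : CNF ℕ) (σ : ℕ → Bool) (j : ℕ) : Bool :=
  if j = 0 then false
  else if j ≤ φ.length then uval σ (φ[j - 1]?.getD []) else σ (j - (φ.length + 1))

/-- `backMap` sets `w` to `false`. [folklore] -/
theorem backMap_zero (φ : CNF ℕ) (σ : ℕ → Bool) : backMap φ σ 0 = false := by
  simp [backMap]

/-- `backMap` sets `uᵢ` to `(x ∨ y)(σ)`. [folklore] -/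
theorem backMap_succ (φ : CNF ℕ) (σ : ℕ → Bool) {i : ℕ} (hi : i < φ.length) :
    backMap φ σ (i + 1) = uval σ φ[i] := by
  simp [backMap, Nat.succ_le_of_lt hi, List.getElem?_eq_getElem hi]

/-- `backMap` is `σ` on the shifted variables. [folklore] -/
theorem backMap_add (φ : CNF ℕ) (σ : ℕ → Bool) (v : ℕ) :
    backMap φ σ (v + (φ.length + 1)) = σ v := by
  have h2 : ¬ v + (φ.length + 1) ≤ φ.length := by omega
  simp [backMap, h2]

/-- Shifting back `backMap σ` recovers `σ`. [folklore] -/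
theorem backShift_backMap (φ : CNF ℕ) (σ : ℕ → Bool) : backShift φ.length (backMap φ σ) = σ :=
  funext (backMap_add φ σ)

/-! ### Shape: normal form, `8m + 1` clauses -/

/-- Each `C̃ᵢ` is a list of complementary pairs of three-literal clauses. [cite: LiskiewiczOgiharaToda2003, §2.3 (proof of Lemma 3)] -/
theorem isComplPairs_lemma3Block (m i : ℕ) (C : Clause ℕ) : IsComplPairs (lemma3Block m i C) := by
  unfold lemma3Block
  split
  · exact ⟨rfl, rfl, rfl, rfl, rfl, rfl, rfl, rfl, trivial⟩
  · exact ⟨rfl, rfl, trivial⟩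

/-- `C̃ᵢ` has eight clauses when `Cᵢ` has three literals. [cite: LiskiewiczOgiharaToda2003, §2.3 ("an eight-clause formula C̃ᵢ")] -/
theorem length_lemma3Block {C : Clause ℕ} (hC : C.length = 3) (m i : ℕ) :
    (lemma3Block m i C).length = 8 := by
  obtain ⟨x, y, z, rfl⟩ := List.length_eq_three.1 hC
  rfl

/-- A clause without exactly three literals is sent to the contradictory pair. [folklore] -/
theorem lemma3Block_of_length_ne {C : Clause ℕ} (hC : C.length ≠ 3) (m i : ℕ) :
    lemma3Block m i C =
      [[(0, true), (0, true), (0, true)], Clause.complement [(0, true), (0, true), (0, true)]] := by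
  unfold lemma3Block
  split
  · simp at hC
  · rfl

/-- **`f(φ)` is in normal form** (for every `φ`, by the treatment of clauses of other widths).
[cite: LiskiewiczOgiharaToda2003, Lemma 3 (1)–(2)] -/
theorem isLOTNormalForm_lemma3Map (φ : CNF ℕ) : IsLOTNormalForm (lemma3Map φ) := by
  rw [lemma3Map, isLOTNormalForm_cons_singleton]
  exact isComplPairs_flatten fun B hB => by
    obtain ⟨i, hi, rfl⟩ := List.mem_mapIdx.1 hB
    exact isComplPairs_lemma3Block _ _ _

/-- **Property (1), clauses**: `f(φ)` has `8m + 1` clauses for a 3CNF `φ` with `m` clauses.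
[cite: LiskiewiczOgiharaToda2003, Lemma 3 (1)] -/
theorem length_lemma3Map {φ : CNF ℕ} (hφ : IsWidthEq 3 φ) :
    (lemma3Map φ).length = 8 * φ.length + 1 := by
  rw [lemma3Map, List.length_cons, List.length_flatten]
  have : (φ.mapIdx fun i C => lemma3Block φ.length i C).map List.length =
      List.replicate φ.length 8 := by
    refine List.ext_getElem (by simp) fun n h1 h2 => ?_
    simp only [List.getElem_map, List.getElem_mapIdx, List.getElem_replicate]
    simp only [List.length_map, List.length_mapIdx] at h1
    exact length_lemma3Block (hφ _ (List.getElem_mem h1)) _ _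
  rw [this, List.sum_replicate, smul_eq_mul]
  omega

/-! ### Semantics of `f(φ)` -/

/-- The clauses of `f(φ)`: the unit clause `(¬w)` and the clauses of the blocks `C̃ᵢ`. [folklore] -/
theorem mem_lemma3Map_iff {φ : CNF ℕ} {c : Clause ℕ} :
    c ∈ lemma3Map φ ↔ c = [(0, false)] ∨ ∃ i, ∃ _ : i < φ.length, c ∈ lemma3Block φ.length i φ[i] := by
  simp only [lemma3Map, List.mem_cons, List.mem_flatten, List.mem_mapIdx]
  constructor
  · rintro (h | ⟨B, ⟨i, hi, rfl⟩, hc⟩)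
    exacts [Or.inl h, Or.inr ⟨i, hi, hc⟩]
  · rintro (h | ⟨i, hi, hc⟩)
    exacts [Or.inl h, Or.inr ⟨_, ⟨i, hi, rfl⟩, hc⟩]

/-- `f(φ)` is true under `τ` iff `τ(w) = false` and every block `C̃ᵢ` is true. [folklore] -/
theorem eval_lemma3Map_iff (φ : CNF ℕ) (τ : ℕ → Bool) :
    (lemma3Map φ).eval τ = true ↔
      τ 0 = false ∧ ∀ i, ∀ _ : i < φ.length, (lemma3Block φ.length i φ[i]).eval τ = true := by
  rw [eval_eq_true_iff]
  constructor
  · intro h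
    refine ⟨?_, fun i hi => (eval_eq_true_iff _ _).2 fun c hc =>
      h c (mem_lemma3Map_iff.2 (Or.inr ⟨i, hi, hc⟩))⟩
    have := h _ (mem_lemma3Map_iff.2 (Or.inl rfl))
    simpa [Clause.eval, Literal.eval] using this
  · rintro ⟨h0, h⟩ c hc
    rcases mem_lemma3Map_iff.1 hc with rfl | ⟨i, hi, hc⟩
    · simp [Clause.eval, Literal.eval, h0]
    · exact (eval_eq_true_iff _ _).1 (h i hi) c hc

/-- **Semantics of a block**: given `τ(w) = false`, the eight clauses `C̃ᵢ` of `(x ∨ y ∨ z)` are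
all true iff `τ(uᵢ) = (x ∨ y)(σ)` and `(x ∨ y ∨ z)(σ)`, where `σ` is `τ` shifted back.
[cite: LiskiewiczOgiharaToda2003, §2.3 (proof of Lemma 3: "every satisfying assignment of ψ sets the value of uᵢ to the value of x ∨ y")] -/
theorem eval_lemma3Block_iff (m i : ℕ) (x y z : Literal ℕ) {τ : ℕ → Bool} (h0 : τ 0 = false) :
    (lemma3Block m i [x, y, z]).eval τ = true ↔
      τ (i + 1) = (x.eval (backShift m τ) || y.eval (backShift m τ)) ∧
        (x.eval (backShift m τ) || y.eval (backShift m τ) || z.eval (backShift m τ)) = true := by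
  have e1 : Literal.eval τ (i + 1, true) = τ (i + 1) := by simp [Literal.eval]
  have e2 : Literal.eval τ (i + 1, false) = !τ (i + 1) := by simp [Literal.eval]
  have e3 : Literal.eval τ (0, true) = false := by simp [Literal.eval, h0]
  have e4 : ∀ l : Literal ℕ, (l.shift (m + 1)).eval τ = l.eval (backShift m τ) := fun l => rfl
  simp only [lemma3Block, eval_cons, eval_nil, Clause.eval, Clause.complement, List.map_cons,
    List.map_nil, List.any_cons, List.any_nil, Literal.eval_negate, e1, e2, e3, e4, Bool.or_false,
    Bool.and_true, Bool.not_false, Bool.not_not]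
  generalize Literal.eval (backShift m τ) x = a
  generalize Literal.eval (backShift m τ) y = b
  generalize Literal.eval (backShift m τ) z = c
  generalize τ (i + 1) = u
  cases a <;> cases b <;> cases c <;> cases u <;> decide

/-- **The satisfying assignments of `f(φ)`** for a 3CNF `φ`: `τ` satisfies `ψ` iff `τ(w) = false`,
`τ(uᵢ) = (x ∨ y)(σ)` for every clause `Cᵢ = (x ∨ y ∨ z)`, and `σ` (= `τ` shifted back)
satisfies `φ`. [cite: LiskiewiczOgiharaToda2003, §2.3 (proof of Lemma 3)] -/
theorem eval_lemma3Map_iff' {φ : CNF ℕ} (hφ : IsWidthEq 3 φ) (τ : ℕ → Bool) :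
    (lemma3Map φ).eval τ = true ↔
      τ 0 = false ∧ (∀ i, ∀ _ : i < φ.length, τ (i + 1) = uval (backShift φ.length τ) φ[i]) ∧
        φ.eval (backShift φ.length τ) = true := by
  rw [eval_lemma3Map_iff]
  constructor
  · rintro ⟨h0, h⟩
    refine ⟨h0, fun i hi => ?_, (eval_eq_true_iff _ _).2 fun C hC => ?_⟩
    · obtain ⟨x, y, z, hC⟩ := List.length_eq_three.1 (hφ _ (List.getElem_mem hi))
      have hb := h i hi
      rw [hC, eval_lemma3Block_iff _ _ _ _ _ h0] at hb
      rw [hC]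
      exact hb.1
    · obtain ⟨i, hi, rfl⟩ := List.getElem_of_mem hC
      obtain ⟨x, y, z, hC'⟩ := List.length_eq_three.1 (hφ _ hC)
      have hb := h i hi
      rw [hC', eval_lemma3Block_iff _ _ _ _ _ h0] at hb
      rw [hC']
      simpa [Clause.eval, or_assoc] using hb.2
  · rintro ⟨h0, hu, hφs⟩
    refine ⟨h0, fun i hi => ?_⟩
    obtain ⟨x, y, z, hC⟩ := List.length_eq_three.1 (hφ _ (List.getElem_mem hi))
    rw [hC, eval_lemma3Block_iff _ _ _ _ _ h0]
    have hu' := hu i hi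
    rw [hC] at hu'
    refine ⟨hu', ?_⟩
    have := (eval_eq_true_iff _ _).1 hφs _ (List.getElem_mem hi)
    rw [hC] at this
    simpa [Clause.eval, or_assoc] using this

/-- Outside 3CNF the map produces an unsatisfiable formula: `#SAT(f(φ)) = 0` if some clause of
`φ` does not have exactly three literals (the contradictory pair `(w ∨ w ∨ w), (¬w ∨ ¬w ∨ ¬w)`
against the unit clause `(¬w)`). Design choice beyond the source, see `lemma3Block`. [folklore] -/
theorem numSat_lemma3Map_of_not_isWidthEq {φ : CNF ℕ} (hφ : ¬ IsWidthEq 3 φ) :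
    (lemma3Map φ).numSat = 0 := by
  rw [numSat_eq_zero_iff]
  rintro ⟨τ, hτ⟩
  obtain ⟨h0, h⟩ := (eval_lemma3Map_iff φ τ).1 hτ
  obtain ⟨C, hC, hlen⟩ : ∃ C ∈ φ, C.length ≠ 3 := by
    by_contra hcon
    exact hφ fun C hC => by_contra fun hlen => hcon ⟨C, hC, hlen⟩
  obtain ⟨i, hi, rfl⟩ := List.getElem_of_mem hC
  have hb := h i hi
  rw [lemma3Block_of_length_ne hlen] at hb
  simp [Clause.eval, Literal.eval, h0] at hb

/-! ### The variables of `f(φ)` -/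

/-- The variables of the literals of `C̃ᵢ` are `w`, `uᵢ`, or shifted variables of `Cᵢ`. [folklore] -/
theorem fst_mem_lemma3Block (m i : ℕ) (C : Clause ℕ) :
    ∀ c ∈ lemma3Block m i C, ∀ l ∈ c, l.1 = 0 ∨ l.1 = i + 1 ∨ ∃ l' ∈ C, l.1 = l'.1 + (m + 1) := by
  unfold lemma3Block
  split
  · intro c hc l hl
    simp only [Clause.complement, List.map_cons, List.map_nil, List.mem_cons, List.not_mem_nil,
      or_false] at hc
    rcases hc with rfl | rfl | rfl | rfl | rfl | rfl | rfl | rfl <;>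
      simp only [List.mem_cons, List.not_mem_nil, or_false] at hl <;>
      rcases hl with rfl | rfl | rfl <;> simp
  · intro c hc l hl
    simp only [Clause.complement, List.map_cons, List.map_nil, List.mem_cons, List.not_mem_nil,
      or_false] at hc
    rcases hc with rfl | rfl <;>
      simp only [List.mem_cons, List.not_mem_nil, or_false] at hl <;>
      rcases hl with rfl | rfl | rfl <;> simp

/-- Each literal of `Cᵢ = (x ∨ y ∨ z)` occurs, shifted, in `C̃ᵢ`. [folklore] -/
theorem shift_mem_lemma3Block (m i : ℕ) {x y z l : Literal ℕ} (hl : l ∈ [x, y, z]) :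
    ∃ c ∈ lemma3Block m i [x, y, z], l.shift (m + 1) ∈ c := by
  simp only [List.mem_cons, List.not_mem_nil, or_false] at hl
  rcases hl with rfl | rfl | rfl
  · exact ⟨_, List.mem_cons_self, by simp⟩
  · exact ⟨_, List.mem_cons_self, by simp⟩
  · exact ⟨[(i + 1, true), l.shift (m + 1), (0, true)], by simp [lemma3Block], by simp⟩

/-- The variables of `f(φ)` are among `w = x₀`, `uᵢ = x_{i+1}` (`i < m`) and the shifted
variables of `φ`. [cite: LiskiewiczOgiharaToda2003, Lemma 3 (1)] -/
theorem mem_vars_lemma3Map {φ : CNF ℕ} {j : ℕ} (hj : j ∈ (lemma3Map φ).vars) :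
    j = 0 ∨ (∃ i < φ.length, j = i + 1) ∨ ∃ v ∈ φ.vars, j = v + (φ.length + 1) := by
  obtain ⟨c, hc, l, hl, rfl⟩ := mem_vars_iff'.1 hj
  rcases mem_lemma3Map_iff.1 hc with rfl | ⟨i, hi, hc⟩
  · simp only [List.mem_singleton] at hl
    subst hl
    exact Or.inl rfl
  · rcases fst_mem_lemma3Block _ _ _ c hc l hl with h | h | ⟨l', hl', h⟩
    · exact Or.inl h
    · exact Or.inr (Or.inl ⟨i, hi, h⟩)
    · exact Or.inr (Or.inr ⟨l'.1, mem_vars_iff'.2 ⟨_, List.getElem_mem hi, l', hl', rfl⟩, h⟩)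

/-- `w = x₀` occurs in `f(φ)`. [cite: LiskiewiczOgiharaToda2003, Lemma 3 (1)] -/
theorem zero_mem_vars_lemma3Map (φ : CNF ℕ) : 0 ∈ (lemma3Map φ).vars :=
  mem_vars_iff'.2 ⟨[(0, false)], mem_lemma3Map_iff.2 (Or.inl rfl), (0, false), by simp, rfl⟩

/-- `uᵢ = x_{i+1}` occurs in `f(φ)` for every clause index `i` of a 3CNF `φ`.
[cite: LiskiewiczOgiharaToda2003, Lemma 3 (1)] -/
theorem succ_mem_vars_lemma3Map {φ : CNF ℕ} (hφ : IsWidthEq 3 φ) {i : ℕ} (hi : i < φ.length) :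
    i + 1 ∈ (lemma3Map φ).vars := by
  obtain ⟨x, y, z, hC⟩ := List.length_eq_three.1 (hφ _ (List.getElem_mem hi))
  refine mem_vars_iff'.2 ⟨[x.shift (φ.length + 1), y.shift (φ.length + 1), (i + 1, false)],
    mem_lemma3Map_iff.2 (Or.inr ⟨i, hi, ?_⟩), (i + 1, false), by simp, rfl⟩
  rw [hC]
  exact List.mem_cons_self

/-- The shifted variable `x_{v+m+1}` occurs in `f(φ)` iff `x_v` occurs in the 3CNF `φ`.
[cite: LiskiewiczOgiharaToda2003, Lemma 3 (1)] -/
theorem add_mem_vars_lemma3Map_iff {φ : CNF ℕ} (hφ : IsWidthEq 3 φ) (v : ℕ) :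
    v + (φ.length + 1) ∈ (lemma3Map φ).vars ↔ v ∈ φ.vars := by
  constructor
  · intro h
    rcases mem_vars_lemma3Map h with h | ⟨i, hi, h⟩ | ⟨v', hv', h⟩
    · omega
    · omega
    · have : v = v' := by omega
      rwa [this]
  · intro hv
    obtain ⟨C, hC, l, hl, rfl⟩ := mem_vars_iff'.1 hv
    obtain ⟨i, hi, rfl⟩ := List.getElem_of_mem hC
    obtain ⟨x, y, z, hC'⟩ := List.length_eq_three.1 (hφ _ hC)
    rw [hC'] at hl
    obtain ⟨c, hc, hlc⟩ := shift_mem_lemma3Block φ.length i hl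
    exact mem_vars_iff'.2 ⟨c, mem_lemma3Map_iff.2 (Or.inr ⟨i, hi, hC' ▸ hc⟩), _, hlc, rfl⟩

/-- **Property (1), variables, as a set**: the variables of `f(φ)` are `w`, the `uᵢ`, and the
shifted variables of `φ`. [cite: LiskiewiczOgiharaToda2003, Lemma 3 (1)] -/
theorem vars_lemma3Map_eq {φ : CNF ℕ} (hφ : IsWidthEq 3 φ) :
    (lemma3Map φ).vars = insert 0 (((Finset.range φ.length).image (· + 1)) ∪
      (φ.vars.image (· + (φ.length + 1)))) := by
  ext j
  simp only [Finset.mem_insert, Finset.mem_union, Finset.mem_image, Finset.mem_range]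
  constructor
  · intro hj
    rcases mem_vars_lemma3Map hj with h | ⟨i, hi, rfl⟩ | ⟨v, hv, rfl⟩
    · exact Or.inl h
    · exact Or.inr (Or.inl ⟨i, hi, rfl⟩)
    · exact Or.inr (Or.inr ⟨v, hv, rfl⟩)
  · rintro (rfl | ⟨i, hi, rfl⟩ | ⟨v, hv, rfl⟩)
    · exact zero_mem_vars_lemma3Map φ
    · exact succ_mem_vars_lemma3Map hφ hi
    · exact (add_mem_vars_lemma3Map_iff hφ v).2 hv

/-- **Property (1), variables**: `f(φ)` has `n + m + 1` variables for a 3CNF `φ` with `n`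
(occurring) variables and `m` clauses. [cite: LiskiewiczOgiharaToda2003, Lemma 3 (1)] -/
theorem card_vars_lemma3Map {φ : CNF ℕ} (hφ : IsWidthEq 3 φ) :
    (lemma3Map φ).vars.card = φ.vars.card + φ.length + 1 := by
  rw [vars_lemma3Map_eq hφ, Finset.card_insert_of_notMem, Finset.card_union_of_disjoint,
    Finset.card_image_of_injective _ (add_left_injective 1), Finset.card_range,
    Finset.card_image_of_injective _ (add_left_injective _)]
  · omega
  · rw [Finset.disjoint_left]
    intro j h1 h2
    simp only [Finset.mem_image, Finset.mem_range] at h1 h2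
    obtain ⟨i, hi, rfl⟩ := h1
    obtain ⟨v, -, hv⟩ := h2
    omega
  · simp only [Finset.mem_union, Finset.mem_image, Finset.mem_range, not_or, not_exists, not_and]
    exact ⟨fun i _ h => by omega, fun v _ h => by omega⟩

/-! ### Equality of the numbers of satisfying assignments -/

/-- **Lemma 3, the count**: `#SAT(f(φ)) = #SAT(φ)` for every 3CNF `φ` — "Clearly, the number of
satisfying assignments of `ψ` is equal to that of `φ`." The bijection sends a satisfying
assignment of `ψ` to its values on the shifted variables; its inverse is `backMap`.
[cite: LiskiewiczOgiharaToda2003, Lemma 3 ("has as many satisfying assignments as φ")] -/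
theorem numSat_lemma3Map {φ : CNF ℕ} (hφ : IsWidthEq 3 φ) : (lemma3Map φ).numSat = φ.numSat := by
  rw [numSat_eq_ncard, numSat_eq_ncard]
  refine Set.ncard_congr (fun τ _ => backShift φ.length τ) ?_ ?_ ?_
  · rintro τ ⟨hoff, hτ⟩
    obtain ⟨-, -, hφs⟩ := (eval_lemma3Map_iff' hφ τ).1 hτ
    exact ⟨fun v hv => hoff _ (mt (add_mem_vars_lemma3Map_iff hφ v).1 hv), hφs⟩
  · rintro τ₁ τ₂ ⟨-, h₁⟩ ⟨-, h₂⟩ heq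
    obtain ⟨h0₁, hu₁, -⟩ := (eval_lemma3Map_iff' hφ τ₁).1 h₁
    obtain ⟨h0₂, hu₂, -⟩ := (eval_lemma3Map_iff' hφ τ₂).1 h₂
    funext j
    rcases Nat.lt_or_ge j (φ.length + 1) with hj | hj
    · rcases j with _ | i
      · rw [h0₁, h0₂]
      · have hi : i < φ.length := by omega
        rw [hu₁ i hi, hu₂ i hi, heq]
    · obtain ⟨v, rfl⟩ : ∃ v, j = v + (φ.length + 1) := ⟨j - (φ.length + 1), by omega⟩
      exact congrFun heq v
  · rintro σ ⟨hoff, hσ⟩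
    refine ⟨backMap φ σ, ⟨fun j hj => ?_, ?_⟩, backShift_backMap φ σ⟩
    · rcases Nat.lt_or_ge j (φ.length + 1) with hjm | hjm
      · rcases j with _ | i
        · exact backMap_zero φ σ
        · exact absurd (succ_mem_vars_lemma3Map hφ (by omega)) hj
      · obtain ⟨v, rfl⟩ : ∃ v, j = v + (φ.length + 1) := ⟨j - (φ.length + 1), by omega⟩
        rw [backMap_add]
        exact hoff v (mt (add_mem_vars_lemma3Map_iff hφ v).2 hj)
    · rw [eval_lemma3Map_iff' hφ, backShift_backMap]
      exact ⟨backMap_zero φ σ, fun i hi => backMap_succ φ σ hi, hσ⟩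

/-- **Lemma 3 of LOT2003 at the level of formulas** (all of it except the running time, which is
a statement about the map on codes): for a 3CNF `φ` with `n` variables and `m` clauses, `f(φ)`
is in normal form — one single-literal clause and complementary pairs of three-literal clauses,
hence property (2) by `IsLOTNormalForm.two_mul_countP_trueCount_eq` — has `8m + 1` clauses and
`n + m + 1` variables, and has exactly as many satisfying assignments as `φ`.
[cite: LiskiewiczOgiharaToda2003, Lemma 3] -/
theorem LOT2003_lemma3_formulas {φ : CNF ℕ} (hφ : IsWidthEq 3 φ) :
    IsLOTNormalForm (lemma3Map φ) ∧ (lemma3Map φ).length = 8 * φ.length + 1 ∧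
      (lemma3Map φ).vars.card = φ.vars.card + φ.length + 1 ∧
        (lemma3Map φ).numSat = φ.numSat :=
  ⟨isLOTNormalForm_lemma3Map φ, length_lemma3Map hφ, card_vars_lemma3Map hφ, numSat_lemma3Map hφ⟩

/-- Sanity check (by `decide`) on `φ = (x₀ ∨ ¬x₁ ∨ x₂)`: `f(φ)` has `9` clauses and is in normal
form. [folklore] -/
theorem lemma3Map_example :
    (lemma3Map [[(0, true), (1, false), (2, true)]]).length = 9 ∧
      IsLOTNormalForm (lemma3Map [[(0, true), (1, false), (2, true)]]) := by
  decide

end CNF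

end Literature.Computability.Complexity
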